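import Summits.KontsevichZagierPeriods.KontsevichZagierPeriods.Theorems.SoloInformedAlgebraicParameterTransfer
import Literature.NumberTheory.Transcendental.LindemannWeierstrassProofs
import Literature.Barriers.KontsevichZagierPeriods.GrothendieckPeriodConjectureDependenceProofs
import HarnessLib

/-!
# SoloInformed — pinning a transcendental value empties a `ℚ`-semialgebraic parameter set

Solo programme `solo-KontsevichZagierPeriods-informed`, session s137, file 3 (sequel of
`SoloInformedAlgebraicParameterTransfer`).  The concluding step of THEOREM R and of COROLLARY SQ
of the programme's `KZ_ℝ` METHOD BARRIER (paper `real-parameters.md`, VERDICT §4), in the kernel: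

* `soloInformed_semialgebraicRat_eq_empty_of_forall_exists_transcendental` — a `ℚ`-semialgebraic
  `W ⊆ ℝᵏ` without algebraic points is empty (file 1: non-empty ⇒ algebraic point);
* `soloInformed_semialgebraicRat_eq_empty_of_aeval_eq` — **if a rational polynomial function takes
  one and the same TRANSCENDENTAL value `τ` at every point of a `ℚ`-semialgebraic `W`, then
  `W = ∅`** (at an algebraic point the value is algebraic);
* the two instances the barrier uses: `…_of_coord_eq_log` (THEOREM R: the parameter set of the
  valid `KZ_ℝ` chains of a fixed shape from `[A, 1]`, `A = {1 ≤ x ≤ 2, 0 ≤ t ≤ 1/x}`, to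
  `[[0,1] × [0,ℓ], 1]` projects into `{ℓ = log 2}` by soundness, hence is empty — no chain) and
  `…_of_sq_eq_pi` (COROLLARY SQ: the parameter set of the tame dissections of the disc onto a square
  of side `s` lies in `{s² = π}`, hence is empty — tame circle squaring is impossible for the reason
  ruler-and-compass squaring is), with the transcendence inputs `transcendental_log_ratCast`
  (Hermite–Lindemann, tree) and `transcendental_pi_holds` (Lindemann, tree);
* `soloInformed_no_valid_parameter_of_value_transcendental` — the schema as the barrier states it:
  a `ℚ`-semialgebraic validity condition on real parameters all of whose solutions carry a fixed
  transcendental polynomial value has no solution.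

What is NOT in the kernel (and keeps THEOREM R / COR SQ on PAPER as stated there): that the validity
of a `KZ_ℝ` chain of fixed shape, resp. of a tame dissection of fixed shape, IS a `ℚ`-semialgebraic
condition on its real parameters (first-order-ness of the move side conditions; Tarski–Seidenberg).

References: paper `real-parameters.md` (THEOREM R, COR SQ); Bochnak–Coste–Roy (1998) §2.2, §5.2.
-/

noncomputable section

namespace Summit.KontsevichZagierPeriods.KontsevichZagierPeriods.Theorems

open Set Literature.ModelTheory.ExponentialFields Literature.NumberTheory.Transcendental

/-- **A `ℚ`-semialgebraic set without algebraic points is empty** (contrapositive of file 1's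
`soloInformed_exists_algebraic_point`). [cite: BochnakCosteRoy1998, §5.2] -/
theorem soloInformed_semialgebraicRat_eq_empty_of_forall_exists_transcendental {k : ℕ}
    {W : Set (Fin k → ℝ)} (hW : IsSemialgebraic ℚ W)
    (h : ∀ p ∈ W, ∃ i, Transcendental ℚ (p i)) : W = ∅ := by
  rcases W.eq_empty_or_nonempty with hemp | hne
  · exact hemp
  · obtain ⟨p, hp, halg⟩ := soloInformed_exists_algebraic_point hW hne
    obtain ⟨i, hi⟩ := h p hp
    exact absurd (halg i) hi

/-- Values of rational polynomials at points with algebraic coordinates are algebraic (integral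
elements form a subring). [folklore] -/
theorem soloInformed_isAlgebraic_aeval_of_forall_isAlgebraic {k : ℕ} {p : Fin k → ℝ}
    (halg : ∀ i, IsAlgebraic ℚ (p i)) (q : MvPolynomial (Fin k) ℚ) :
    IsAlgebraic ℚ (MvPolynomial.aeval p q) := by
  have hint : ∀ r : MvPolynomial (Fin k) ℚ, IsIntegral ℚ (MvPolynomial.aeval p r) := fun r => by
    induction r using MvPolynomial.induction_on with
    | C a => simpa using isIntegral_algebraMap (R := ℚ) (A := ℝ) (x := a)
    | add r s hr hs => simpa using hr.add hs
    | mul_X r i hr => simpa using hr.mul (halg i).isIntegral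
  exact (hint q).isAlgebraic

/-- **Pinning a transcendental value empties a `ℚ`-semialgebraic set.** If a polynomial function
with rational coefficients takes the same transcendental value `τ` at every point of a
`ℚ`-semialgebraic `W ⊆ ℝᵏ`, then `W = ∅`: a non-empty `W` has an algebraic point (file 1), where the
value is algebraic.  This is the concluding step of THEOREM R and of COROLLARY SQ of the `KZ_ℝ`
method barrier. [cite: BochnakCosteRoy1998, §5.2] -/
theorem soloInformed_semialgebraicRat_eq_empty_of_aeval_eq {k : ℕ} {W : Set (Fin k → ℝ)}
    (hW : IsSemialgebraic ℚ W) (q : MvPolynomial (Fin k) ℚ) {τ : ℝ} (hτ : Transcendental ℚ τ)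
    (h : ∀ p ∈ W, MvPolynomial.aeval p q = τ) : W = ∅ := by
  rcases W.eq_empty_or_nonempty with hemp | hne
  · exact hemp
  · obtain ⟨p, hp, halg⟩ := soloInformed_exists_algebraic_point hW hne
    have hτalg : IsAlgebraic ℚ τ := by
      rw [← h p hp]
      exact soloInformed_isAlgebraic_aeval_of_forall_isAlgebraic halg q
    exact absurd hτalg hτ

/-- **THEOREM R's concluding step.** A `ℚ`-semialgebraic set of real parameter vectors one of whose
coordinates is pinned to `log q` (`q > 0`, `q ≠ 1` rational; `log 2` in THEOREM R) is empty —
`log q` is transcendental (Hermite–Lindemann, the tree's `transcendental_log_ratCast`).  In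
THEOREM R the set is the (Tarski–Seidenberg) parameter set of the valid fixed-shape `KZ_ℝ` chains
from `[A, 1]` (area `log 2`) to `[[0,1] × [0,ℓ], 1]`, whose `ℓ`-coordinate equals `log 2` by the
soundness of the moves. [cite: Fresan2024, Ex. 2.5] -/
theorem soloInformed_semialgebraicRat_eq_empty_of_coord_eq_log {k : ℕ} {W : Set (Fin k → ℝ)}
    (hW : IsSemialgebraic ℚ W) (i : Fin k) (q : ℚ) (hq : 0 < q) (hq1 : q ≠ 1)
    (h : ∀ p ∈ W, p i = Real.log q) : W = ∅ :=
  soloInformed_semialgebraicRat_eq_empty_of_aeval_eq hW (MvPolynomial.X i)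
    (Literature.Barriers.KontsevichZagierPeriods.transcendental_log_ratCast q hq hq1)
    fun p hp => by simpa using h p hp

/-- **COROLLARY SQ's concluding step** (tame circle squaring).  A `ℚ`-semialgebraic set of real
parameter vectors with a coordinate `s` satisfying `s² = π` at every point — the side of a square
of area `π`, as forced by volume preservation for a dissection of the unit disc onto `[0,s]²` — is
empty, `π` being transcendental (Lindemann; the tree's `transcendental_pi_holds`).
[cite: Lindemann1882, via BakerTNT1975 Ch. 1 Theorem 1.3, p. 5] -/
theorem soloInformed_semialgebraicRat_eq_empty_of_sq_eq_pi {k : ℕ} {W : Set (Fin k → ℝ)}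
    (hW : IsSemialgebraic ℚ W) (i : Fin k) (h : ∀ p ∈ W, p i ^ 2 = Real.pi) : W = ∅ :=
  soloInformed_semialgebraicRat_eq_empty_of_aeval_eq hW (MvPolynomial.X i ^ 2)
    transcendental_pi_holds fun p hp => by simpa using h p hp

/-- The same with the volume of any target read off polynomially: if a rational polynomial in the
parameters equals `π` on `W` (e.g. the volume `a · b` of a target rectangle `[0,a] × [0,b]`), then
`W = ∅`. [cite: Lindemann1882, via BakerTNT1975 Ch. 1 Theorem 1.3, p. 5] -/
theorem soloInformed_semialgebraicRat_eq_empty_of_aeval_eq_pi {k : ℕ} {W : Set (Fin k → ℝ)}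
    (hW : IsSemialgebraic ℚ W) (q : MvPolynomial (Fin k) ℚ)
    (h : ∀ p ∈ W, MvPolynomial.aeval p q = Real.pi) : W = ∅ :=
  soloInformed_semialgebraicRat_eq_empty_of_aeval_eq hW q transcendental_pi_holds h

/-- **The barrier's schema.** Let `Valid` be a condition on real parameter vectors whose solution
set is `ℚ`-semialgebraic (for fixed-shape `KZ_ℝ` chains: first-order-ness of the move side
conditions + Tarski–Seidenberg — the PAPER part), and suppose soundness forces a rational
polynomial `value` of the parameters to equal a fixed transcendental `τ` at every solution.  Then
there is no solution.  (With `soloInformed_realParameter_transfer` of file 1 — every solvable such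
condition has an ALGEBRAIC solution — this is the whole real-algebraic content of THEOREMS R, T and
COROLLARY SQ.) [cite: BochnakCosteRoy1998, §5.2] -/
theorem soloInformed_no_valid_parameter_of_value_transcendental {k : ℕ}
    {Valid : (Fin k → ℝ) → Prop} (hV : IsSemialgebraic ℚ {p | Valid p})
    (value : MvPolynomial (Fin k) ℚ) {τ : ℝ} (hτ : Transcendental ℚ τ)
    (hsound : ∀ p, Valid p → MvPolynomial.aeval p value = τ) : ∀ p, ¬ Valid p := by
  intro p hp
  have hempty := soloInformed_semialgebraicRat_eq_empty_of_aeval_eq hV value hτ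
    fun p' hp' => hsound p' hp'
  have : p ∈ ({p | Valid p} : Set (Fin k → ℝ)) := hp
  rw [hempty] at this
  exact this

end Summit.KontsevichZagierPeriods.KontsevichZagierPeriods.Theorems
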